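import Summits.PneNP.PneNP.Theorems.UniformMagnification.Negative.DrainMachines
import Literature.Computability.MetaComplexity.MCSP
import Literature.Computability.MetaComplexity.TruthTablesProofs
import Literature.Computability.Complexity.TM2PassThrough
import Literature.Computability.Complexity.NSubexp
import Literature.Computability.Complexity.NTIMEMono
import Literature.Computability.Complexity.TimeToSpace
import Literature.Computability.AlgebraicComplexity.RazMonomialCircuits

/-!
# Route UniformStream — uniform streaming witness, part 3: the witness theorems

All budgets are `s (Nat.log 2 N) ^ c + c`.

* `uniformClass_witness` — for `n ≤ s n` and `3 ≤ c` the four machine/space clauses common to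
  `UniformStreamLB` / `DodgeNonuniformity` / `UniformMagnification` hold simultaneously for `powAlg` with
  `InitTM.aux`, `UpdateTM.aux`, `AcceptTM.aux`, which decides `{x | ∃ k, |x| = 2 ^ k}`: the typed uniform
  class is not empty for silly reasons (route text, "cheapest falsifier (i)");
* `MCSPSize_eq_setOf_pow_two` — for `s ≥ univBound` (`5·2ⁿ - 4`) `MCSPSize s` IS that language, hence
* `magnificationConsequent_at_large_size` — the CONSEQUENT of `UniformMagnification` holds unconditionally
  at the time-constructible `s n = 5 · 2 ^ n + 5` (no `P = NP` needed: the typed consequent is not false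
  for model reasons), and `not_uniformStreamLB_at_large_size` — the matrix of `UniformStreamLB` fails at
  every `s ≥ univBound` with `s n ≥ n` (its witness `s` must be genuinely small);
* `consequent_false_at_size_zero` — dropping the growth clause `n ≤ s n` of `IsTimeConstructible`, the
  consequent FAILS (at `s ≡ 0` the budget is constant and no init machine can even read `N`,
  `initClause_false_at_constant`, by input consumption `length_input_le_of_outputsWithin`): the growth
  clause is load-bearing, and the time-constructibility-free variant of the crux would restate `PneNP`.

[McKay–Murray–Williams 2019, Thm 1.3 and §2; Arora–Barak 2009, §1.2] [folklore]
-/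

set_option linter.dupNamespace false -- `Summit.PneNP.PneNP.…`: summit = sub-problem (D-0017 single-conjunct layout)

namespace Summit.PneNP.PneNP.Theorems.UniformMagnification.Negative

open Turing Computability
open Literature.Computability.Complexity Literature.Computability.MetaComplexity
open Literature.Computability.Complexity.PairFstTM (initList_stk_self initList_stk_ne haltList_stk_self
  haltList_stk_ne)
open Literature.Computability.Complexity.TM2Comp (iterate_bind_succ)

/-! ### The witness theorems -/

/-- Budget arithmetic: `n + 2 ≤ s n ^ c + c` for `n ≤ s n`, `3 ≤ c`. [folklore] -/
theorem log_add_two_le_budget {s : ℕ → ℕ} (hs : ∀ n, n ≤ s n) {c : ℕ} (hc : 3 ≤ c) (n : ℕ) :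
    n + 2 ≤ s n ^ c + c := by
  have h1 : s n ≤ s n ^ c := Nat.le_self_pow (by omega) (s n)
  have h2 := hs n
  omega

/-- **The uniform streaming class is inhabited.** For every size bound `s` with `s n ≥ n` and every
`c ≥ 3`, the algorithm `powAlg` with the machines `InitTM.aux`, `UpdateTM.aux`, `AcceptTM.aux`
satisfies all four machine/space clauses of `UniformStreamLB` / `DodgeNonuniformity` /
`UniformMagnification` at the budget `s (Nat.log 2 N) ^ c + c` and decides the power-of-two-length
language. [McKay–Murray–Williams 2019, §2] [folklore] -/
theorem uniformClass_witness (s : ℕ → ℕ) (hs : ∀ n, n ≤ s n) (c : ℕ) (hc : 3 ≤ c) :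
    ∃ (A : StreamingAlgorithm) (M₀ M₁ M₂ : TM2ComputableAux Bool Bool),
      A.HasSpace (fun N => s (Nat.log 2 N) ^ c + c) ∧
      (∀ N : ℕ, M₀.OutputsWithin (encodeNat N) (A.init N) (s (Nat.log 2 N) ^ c + c)) ∧
      (∀ (N : ℕ) (st : List Bool) (b : Bool), st.length ≤ s (Nat.log 2 N) ^ c + c →
        M₁.OutputsWithin (boolPair st [b]) (A.update N st b) (s (Nat.log 2 N) ^ c + c)) ∧
      (∀ (N : ℕ) (st : List Bool), st.length ≤ s (Nat.log 2 N) ^ c + c →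
        M₂.OutputsWithin st (encodeBool (A.accept N st)) (s (Nat.log 2 N) ^ c + c)) ∧
      A.Decides {x | ∃ k, x.length = 2 ^ k} := by
  refine ⟨powAlg, InitTM.aux, UpdateTM.aux, AcceptTM.aux, ?_, ?_, ?_, ?_, powAlg_decides⟩
  · exact powAlg_hasSpace _ fun N => by have := log_add_two_le_budget hs hc (Nat.log 2 N); omega
  · intro N
    refine (InitTM.outputsWithin N).mono ?_
    have h1 := TM2Pass.length_encodeNat_le N
    have h2 := log_add_two_le_budget hs hc (Nat.log 2 N)
    omega
  · intro N st b hst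
    refine (UpdateTM.outputsWithin st b).mono ?_
    have h2 := log_add_two_le_budget hs hc (Nat.log 2 N)
    omega
  · intro N st hst
    refine (AcceptTM.outputsWithin st).mono ?_
    have h2 := log_add_two_le_budget hs hc (Nat.log 2 N)
    omega

/-- **`MCSP[s]` is the power-of-two-length language for `s ≥ univBound`** (every `n`-ary function has
a `B₂`-circuit of size `≤ univBound n = 5·2ⁿ - 4`). [Jukna 2012, §1.1] [folklore] -/
theorem MCSPSize_eq_setOf_pow_two (s : ℕ → ℕ) (hs : ∀ n, univBound n ≤ s n) :
    MCSPSize s = {x | ∃ k, x.length = 2 ^ k} := by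
  ext x
  constructor
  · rintro ⟨n, f, rfl, -⟩
    exact ⟨n, length_truthTable f⟩
  · rintro ⟨n, hn⟩
    refine ⟨n, ofTruthTable x hn, (truthTable_ofTruthTable x hn).symm, ?_⟩
    obtain ⟨C, hB, hC, hsz⟩ := exists_computes_B2_size_le (ofTruthTable x hn)
    exact ((circuitSizeOver_le_of_computes C hB hC).trans hsz).trans (hs n)

/-- **The consequent of `UniformMagnification` holds unconditionally at a large size bound**: for the
time-constructible `s n = 5 · 2ⁿ + 5` there are `c` and ONE uniform streaming algorithm with its three
machines within `s (⌊log₂ N⌋) ^ c + c` space and steps deciding `MCSPSize s` — no `P = NP` needed, so the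
typed consequent is not false for model reasons. [McKay–Murray–Williams 2019, Thm 1.3] [folklore] -/
theorem magnificationConsequent_at_large_size :
    ∃ s : ℕ → ℕ, IsTimeConstructible s ∧ ∃ (c : ℕ) (A : StreamingAlgorithm)
      (M₀ M₁ M₂ : TM2ComputableAux Bool Bool),
      A.HasSpace (fun N => s (Nat.log 2 N) ^ c + c) ∧
      (∀ N : ℕ, M₀.OutputsWithin (encodeNat N) (A.init N) (s (Nat.log 2 N) ^ c + c)) ∧
      (∀ (N : ℕ) (st : List Bool) (b : Bool), st.length ≤ s (Nat.log 2 N) ^ c + c →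
        M₁.OutputsWithin (boolPair st [b]) (A.update N st b) (s (Nat.log 2 N) ^ c + c)) ∧
      (∀ (N : ℕ) (st : List Bool), st.length ≤ s (Nat.log 2 N) ^ c + c →
        M₂.OutputsWithin st (encodeBool (A.accept N st)) (s (Nat.log 2 N) ^ c + c)) ∧
      A.Decides (MCSPSize s) := by
  have hs : IsTimeConstructible fun n => 5 * 2 ^ n + 5 :=
    TimeConstructible.isTimeConstructible_two_pow.mul_add (by norm_num)
  refine ⟨fun n => 5 * 2 ^ n + 5, hs, 3, ?_⟩
  have hge : ∀ n, univBound n ≤ 5 * 2 ^ n + 5 := fun n => by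
    have := Literature.Computability.AlgebraicComplexity.RazMonomialCkt.univBound_add_four n; omega
  rw [MCSPSize_eq_setOf_pow_two _ hge]
  exact uniformClass_witness _ hs.1 3 le_rfl

/-- **The matrix of `UniformStreamLB` fails at every large size bound**: for `s ≥ univBound` with
`s n ≥ n`, it is false that for every `c` no uniform streaming algorithm with budget
`s (⌊log₂ N⌋) ^ c + c` decides `MCSPSize s` (take `c = 3`). The witness `s` of `UniformStreamLB` must
therefore be a genuinely small size bound. [McKay–Murray–Williams 2019, Thm 1.3] [folklore] -/
theorem not_uniformStreamLB_at_large_size (s : ℕ → ℕ) (hs : ∀ n, n ≤ s n)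
    (hu : ∀ n, univBound n ≤ s n) :
    ¬ ∀ c : ℕ, ¬ ∃ (A : StreamingAlgorithm) (M₀ M₁ M₂ : TM2ComputableAux Bool Bool),
      A.HasSpace (fun N => s (Nat.log 2 N) ^ c + c) ∧
      (∀ N : ℕ, M₀.OutputsWithin (encodeNat N) (A.init N) (s (Nat.log 2 N) ^ c + c)) ∧
      (∀ (N : ℕ) (st : List Bool) (b : Bool), st.length ≤ s (Nat.log 2 N) ^ c + c →
        M₁.OutputsWithin (boolPair st [b]) (A.update N st b) (s (Nat.log 2 N) ^ c + c)) ∧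
      (∀ (N : ℕ) (st : List Bool), st.length ≤ s (Nat.log 2 N) ^ c + c →
        M₂.OutputsWithin st (encodeBool (A.accept N st)) (s (Nat.log 2 N) ^ c + c)) ∧
      A.Decides (MCSPSize s) := by
  intro h
  apply h 3
  rw [MCSPSize_eq_setOf_pow_two _ hu]
  exact uniformClass_witness s hs 3 le_rfl

/-! ### The growth clause `n ≤ s n` is load-bearing -/

/-- **Input consumption.** A machine halting within `m` steps has popped its whole input: so
`|l| ≤ |l'| + P · m` with `P = machinePopBound` the pops per step. [Arora–Barak 2009, §1.2] [folklore] -/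
theorem length_input_le_of_outputsWithin {Γ₀ Γ₁ : Type} (M : TM2ComputableAux Γ₀ Γ₁) {l : List Γ₀}
    {l' : List Γ₁} {m : ℕ} (h : M.OutputsWithin l l' m) :
    l.length ≤ l'.length + TimeToSpace.machinePopBound M.tm * m := by
  obtain ⟨⟨⟨n, hn⟩, hnm⟩⟩ := h
  have h1 := TimeToSpace.stkLen_le_of_iterate M.tm hn
  rw [SpaceLoop.stkLen_initList, TimeToSpace.stkLen_haltList, List.length_map, List.length_map] at h1
  have h2 : TimeToSpace.machinePopBound M.tm * n ≤ TimeToSpace.machinePopBound M.tm * m :=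
    Nat.mul_le_mul_left _ hnm
  omega

/-- **No init machine works within a CONSTANT budget**: with space and init time both bounded by a
constant `B`, the init machine would have to consume the `⌊log₂ N⌋ + 1` digits of `encodeNat N` in
`B` steps. [folklore] -/
theorem initClause_false_at_constant (B : ℕ) :
    ¬ ∃ (A : StreamingAlgorithm) (M₀ : TM2ComputableAux Bool Bool),
      A.HasSpace (fun _ => B) ∧ ∀ N : ℕ, M₀.OutputsWithin (encodeNat N) (A.init N) B := by
  rintro ⟨A, M₀, hA, hM⟩
  have h1 := length_input_le_of_outputsWithin M₀
    (hM (2 ^ (B + TimeToSpace.machinePopBound M₀.tm * B)))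
  have h2 := (hA (2 ^ (B + TimeToSpace.machinePopBound M₀.tm * B))).1
  rw [TM2Pass.length_encodeNat_eq_size, Nat.size_pow] at h1
  simp only at h2
  omega

/-- **Dropping the growth clause `n ≤ s n` of `IsTimeConstructible`, the consequent of
`UniformMagnification` FAILS** — at the size bound `s ≡ 0` the budget `s (⌊log₂ N⌋) ^ c + c = 0 ^ c + c`
is constant, and `initClause_false_at_constant` applies. Hence the growth clause is load-bearing: the
variant `¬ PneNP → ∀ s, ∃ c A M₀ M₁ M₂, …` (no time-constructibility) would be equivalent to `PneNP`
itself, i.e. would merely restate the summit. [folklore] -/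
theorem consequent_false_at_size_zero :
    ¬ ∃ (c : ℕ) (A : StreamingAlgorithm) (M₀ M₁ M₂ : TM2ComputableAux Bool Bool),
      A.HasSpace (fun N => (fun _ : ℕ => 0) (Nat.log 2 N) ^ c + c) ∧
      (∀ N : ℕ, M₀.OutputsWithin (encodeNat N) (A.init N) ((fun _ : ℕ => 0) (Nat.log 2 N) ^ c + c)) ∧
      (∀ (N : ℕ) (st : List Bool) (b : Bool), st.length ≤ (fun _ : ℕ => 0) (Nat.log 2 N) ^ c + c →
        M₁.OutputsWithin (boolPair st [b]) (A.update N st b) ((fun _ : ℕ => 0) (Nat.log 2 N) ^ c + c)) ∧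
      (∀ (N : ℕ) (st : List Bool), st.length ≤ (fun _ : ℕ => 0) (Nat.log 2 N) ^ c + c →
        M₂.OutputsWithin st (encodeBool (A.accept N st)) ((fun _ : ℕ => 0) (Nat.log 2 N) ^ c + c)) ∧
      A.Decides (MCSPSize fun _ => 0) := by
  rintro ⟨c, A, M₀, M₁, M₂, hA, hM₀, -, -, -⟩
  exact initClause_false_at_constant (0 ^ c + c) ⟨A, M₀, hA, hM₀⟩


end Summit.PneNP.PneNP.Theorems.UniformMagnification.Negative
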